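import Mathlib
import Summits.NavierStokesRegularity.OSWSelfSimilar.TypeIIModulatedEnergy
import HarnessLib
/-!
# Local energies of the modulated ansatz about a GENERAL centre `x*` (zone Z1 TEMPLATE (C1)/(C3)/(C10)/(C11) with
# `B_ρ(x*)` — kernel-checked; the translation of part IV)

HONEST FRAMING (cell ns-blowup GROUP B «PROFILE SEARCH», zone Z1 «Type-II log-modulated DSS ansatz for axisymmetric
Navier–Stokes — the template IS the deliverable»; D-0035/D-0074): part X of the Z1 dictionary. Part IV
(`TypeIIModulatedEnergy`) kernel-checked the energy dictionary of TEMPLATE (C1)/(C3)/(C10)/(C11) for the symmetric class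
`x* ≡ 0` (balls about the origin); §T1.18 (K6)/§T1.19 (K12) list «the general-centre versions (a translation)» as not
typed. Here they are, for `u(x) = λ⁻¹ V(λ⁻¹(x − x*))` on the balls `B_ρ(x*)` of TEMPLATE (C1)/(C10)/(C11):

* `setIntegral_ball_comp_inv_smul_sub` — the change of variables `∫_{B(x*,ρ)} g(λ⁻¹(x − x*)) dx = λ³ ∫_{B(0,ρ/λ)} g`;
* `setIntegral_ball_normSq_modulated_centre` — (C10): `∫_{B_ρ(x*)} ‖u‖² = λ ∫_{B_{ρ/λ}} ‖V‖²`;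
* `scaledEnergy_modulated_centre` — (C1): `ρ⁻¹∫_{B_ρ(x*)}‖u‖² = R⁻¹∫_{B_R}‖V‖²`, `R = ρ/λ`;
* `setIntegral_ball_normCube_modulated_centre` — (C3): `∫_{B_ρ(x*)}‖u‖³ = ∫_{B_{ρ/λ}}‖V‖³`;
* `setIntegral_ball_gradSq_modulated_centre` — (C11): `∫_{B_ρ(x*)}|∇u|²_F = λ⁻¹∫_{B_{ρ/λ}}|∇V|²_F`.

Translation invariance of Lebesgue measure (`MeasureTheory.integral_sub_right_eq_self`) + part IV. **Nothing here is a
statement about a Navier–Stokes solution**: identities valid for every `V`, every `λ > 0`, every centre. «violates: n/a —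
dictionary»; bears_on LADDER-NS N5/Z1 → N1 linear core / N0⁻. Author: ns-blowup-profile-eng-1 g5, 2026-08-27.
-/

open Real Filter Topology Set MeasureTheory
open scoped RealInnerProductSpace
open Literature.Analysis.FluidPDE

namespace Summit.NavierStokesRegularity.OSWSelfSimilar
namespace TypeIIModulationDictionary

/-- **Translation of a ball integral**: `∫_{B(x*, ρ)} h(x − x*) dx = ∫_{B(0, ρ)} h(y) dy` for any `h : ℝ³ → ℝ`
(translation invariance of Lebesgue measure, via indicators). [new here — dictionary] -/
theorem setIntegral_ball_comp_sub (xc : EuclideanSpace ℝ (Fin 3)) (ρ : ℝ) (h : EuclideanSpace ℝ (Fin 3) → ℝ) :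
    ∫ x in Metric.ball xc ρ, h (x - xc) = ∫ y in Metric.ball (0 : EuclideanSpace ℝ (Fin 3)) ρ, h y := by
  rw [← integral_indicator Metric.isOpen_ball.measurableSet, ← integral_indicator Metric.isOpen_ball.measurableSet]
  have hind : (Metric.ball xc ρ).indicator (fun x => h (x - xc))
      = fun x => (Metric.ball (0 : EuclideanSpace ℝ (Fin 3)) ρ).indicator h (x - xc) := by
    funext x
    have hmem : x ∈ Metric.ball xc ρ ↔ x - xc ∈ Metric.ball (0 : EuclideanSpace ℝ (Fin 3)) ρ := by
      rw [Metric.mem_ball, Metric.mem_ball, dist_eq_norm, dist_zero_right]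
    by_cases hx : x ∈ Metric.ball xc ρ
    · rw [indicator_of_mem hx, indicator_of_mem (hmem.1 hx)]
    · rw [indicator_of_notMem hx, indicator_of_notMem (fun h' => hx (hmem.2 h'))]
  rw [hind, integral_sub_right_eq_self (fun y => (Metric.ball (0 : EuclideanSpace ℝ (Fin 3)) ρ).indicator h y) xc]

/-- **The change of variables about a general centre**: for `λ > 0`,
`∫_{B(x*, ρ)} g(λ⁻¹(x − x*)) dx = λ³ ∫_{B(0, ρ/λ)} g(y) dy`. [new here — dictionary] -/
theorem setIntegral_ball_comp_inv_smul_sub {lam : ℝ} (hlam : 0 < lam) (xc : EuclideanSpace ℝ (Fin 3)) (ρ : ℝ)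
    (g : EuclideanSpace ℝ (Fin 3) → ℝ) :
    ∫ x in Metric.ball xc ρ, g (lam⁻¹ • (x - xc))
      = lam ^ 3 * ∫ y in Metric.ball (0 : EuclideanSpace ℝ (Fin 3)) (ρ / lam), g y := by
  rw [setIntegral_ball_comp_sub xc ρ (fun y => g (lam⁻¹ • y)), setIntegral_ball_comp_inv_smul hlam ρ g]

/-- **TEMPLATE (C10) about a general centre**: for `λ > 0`, any centre `x*` and any `V : ℝ³ → ℝ³`,
`∫_{B_ρ(x*)} ‖λ⁻¹V(λ⁻¹(x − x*))‖² dx = λ ∫_{B_{ρ/λ}} ‖V‖²`. [new here — dictionary] -/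
theorem setIntegral_ball_normSq_modulated_centre {lam : ℝ} (hlam : 0 < lam) (xc : EuclideanSpace ℝ (Fin 3)) (ρ : ℝ)
    (V : EuclideanSpace ℝ (Fin 3) → EuclideanSpace ℝ (Fin 3)) :
    ∫ x in Metric.ball xc ρ, ‖lam⁻¹ • V (lam⁻¹ • (x - xc))‖ ^ 2
      = lam * ∫ y in Metric.ball (0 : EuclideanSpace ℝ (Fin 3)) (ρ / lam), ‖V y‖ ^ 2 := by
  rw [setIntegral_ball_comp_sub xc ρ (fun y => ‖lam⁻¹ • V (lam⁻¹ • y)‖ ^ 2), setIntegral_ball_normSq_modulated hlam ρ V]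

/-- **TEMPLATE (C1) about a general centre** (Seregin's `A(r)` at the blow-up centre `x*`):
`ρ⁻¹∫_{B_ρ(x*)}‖u‖² = R⁻¹∫_{B_R}‖V‖²`, `R = ρ/λ` (`λ, ρ > 0`). [new here — dictionary] -/
theorem scaledEnergy_modulated_centre {lam ρ : ℝ} (hlam : 0 < lam) (hρ : 0 < ρ) (xc : EuclideanSpace ℝ (Fin 3))
    (V : EuclideanSpace ℝ (Fin 3) → EuclideanSpace ℝ (Fin 3)) :
    ρ⁻¹ * ∫ x in Metric.ball xc ρ, ‖lam⁻¹ • V (lam⁻¹ • (x - xc))‖ ^ 2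
      = (ρ / lam)⁻¹ * ∫ y in Metric.ball (0 : EuclideanSpace ℝ (Fin 3)) (ρ / lam), ‖V y‖ ^ 2 := by
  rw [setIntegral_ball_comp_sub xc ρ (fun y => ‖lam⁻¹ • V (lam⁻¹ • y)‖ ^ 2), scaledEnergy_modulated hlam hρ V]

/-- **TEMPLATE (C3) about a general centre**: `∫_{B_ρ(x*)}‖λ⁻¹V(λ⁻¹(x − x*))‖³ dx = ∫_{B_{ρ/λ}}‖V‖³` (`λ > 0`).
[new here — dictionary] -/
theorem setIntegral_ball_normCube_modulated_centre {lam : ℝ} (hlam : 0 < lam) (xc : EuclideanSpace ℝ (Fin 3)) (ρ : ℝ)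
    (V : EuclideanSpace ℝ (Fin 3) → EuclideanSpace ℝ (Fin 3)) :
    ∫ x in Metric.ball xc ρ, ‖lam⁻¹ • V (lam⁻¹ • (x - xc))‖ ^ 3
      = ∫ y in Metric.ball (0 : EuclideanSpace ℝ (Fin 3)) (ρ / lam), ‖V y‖ ^ 3 := by
  rw [setIntegral_ball_comp_sub xc ρ (fun y => ‖lam⁻¹ • V (lam⁻¹ • y)‖ ^ 3), setIntegral_ball_normCube_modulated hlam ρ V]

/-- **TEMPLATE (C11) about a general centre**: `∫_{B_ρ(x*)} |∇(λ⁻¹V(λ⁻¹(· − x*)))|_F² = λ⁻¹ ∫_{B_{ρ/λ}} |∇V|_F²` (`λ > 0`; the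
tree's `frobeniusNormSq` of the Fréchet derivative; junk-consistent, no differentiability hypothesis). [new here — dictionary] -/
theorem setIntegral_ball_gradSq_modulated_centre {lam : ℝ} (hlam : 0 < lam) (xc : EuclideanSpace ℝ (Fin 3)) (ρ : ℝ)
    (V : EuclideanSpace ℝ (Fin 3) → EuclideanSpace ℝ (Fin 3)) :
    ∫ x in Metric.ball xc ρ, frobeniusNormSq (fderiv ℝ (fun z => lam⁻¹ • V (lam⁻¹ • (z - xc))) x)
      = lam⁻¹ * ∫ y in Metric.ball (0 : EuclideanSpace ℝ (Fin 3)) (ρ / lam), frobeniusNormSq (fderiv ℝ V y) := by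
  have hD : ∀ x, fderiv ℝ (fun z => lam⁻¹ • V (lam⁻¹ • (z - xc))) x
      = fderiv ℝ (fun z => lam⁻¹ • V (lam⁻¹ • z)) (x - xc) := by
    intro x
    rw [show (fun z => lam⁻¹ • V (lam⁻¹ • (z - xc))) = fun z => (fun w => lam⁻¹ • V (lam⁻¹ • w)) (z - xc) from rfl,
      fderiv_comp_sub (f := fun w => lam⁻¹ • V (lam⁻¹ • w)) xc]
  simp_rw [hD]
  rw [setIntegral_ball_comp_sub xc ρ (fun y => frobeniusNormSq (fderiv ℝ (fun z => lam⁻¹ • V (lam⁻¹ • z)) y)),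
    setIntegral_ball_gradSq_modulated hlam ρ V]

end TypeIIModulationDictionary
end Summit.NavierStokesRegularity.OSWSelfSimilar
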